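import Summits.KontsevichZagierPeriods.KontsevichZagierPeriods.Theorems.TerasomaMultiplicationBetaCancellationWallDescent

/-!
# Side descent: `π`-cancellation for certificates respecting ANY side set of the first disc coordinate

General form of the restriction method of seats c7/c8 (crux lead, `--supports`
stmt-KontsevichZagierPeriods-13633, line `dirichlet-companion-to-pi`). Fix an arbitrary *side set*
`S ⊆ ℝ` such that the half-cylinders `{z | z 0 ∈ S}` are `ℚ`-semialgebraic in every dimension `≥ 1`.
The **`S`-respecting generators** (written inline, no definition) are: all additivity moves, the
changes of variables `Φ` of `(n+1)`-dimensional representations with `Φ x 0 ∈ S ↔ x 0 ∈ S` on the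
domain (they may move `x 0` arbitrarily inside `S` and inside its complement), and the Newton–Leibniz
moves over a base of dimension `≥ 1`.

* `sideRestrict_of_side` — restriction to `{z 0 ∈ S}` (any additive `H` killing constants and pinned
  on generators by `H [r] = [r ∩ {z 0 ∈ S}]`) maps the closure of the `S`-respecting generators into
  `relations` (the generator lemmas of `…StubWallRestrict.lean`, p119124, are already stated for a
  general side set);
* `sideLift` — on the pinned disc family, `H (lift (of ∘ P) c) ≡ [D_S] * c` where `D_S` is any
  representation with domain `piDisc ∩ {z | z 0 ∈ S}` and integrand `1`;
* `sideDescent` — **MASTER THEOREM**: if the disc piece `D_S` *finishes* — `[D_S]·c ∈ relations` and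
  `[π]·c ∈ relations` force `c ∈ relations` — then `π`-cancellation holds for every certificate in the
  closure of the `S`-respecting generators.

Which `S` finish is decided on the disc alone (`S` is free outside `[-1,1]`): the trace must be a
union of the four arcs cut out by `x ∈ {-1/2, 0, 1/2}` whose class has a non-zero algebraic constant
term modulo `[D]` (e.g. `(-∞,-1/2)`: `([D] − 3√3/4)/3`; the central band `(-1/2,1/2)`; the quarter
bands); the instances are assembled in `…SideDescentInstances.lean`. For `S = (-∞,-1/2)` the
`S`-respecting class strictly contains the wall-respecting class of `…WallDescent.lean` (one-sided
condition), which strictly contains `KZ.fibredRelations`.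
-/

noncomputable section

-- `Summit.KontsevichZagierPeriods.KontsevichZagierPeriods.…` is the tree's mandated layout (single-conjunct summit).
set_option linter.dupNamespace false

namespace Summit.KontsevichZagierPeriods.KontsevichZagierPeriods.BetaCancellationLine

open Set
open Literature.NumberTheory.Transcendental
open Literature.NumberTheory.Transcendental.KZ

/-! ### Restriction to a side set maps side-respecting relations to relations -/

/-- **Side restriction**: for a side set `S` with `ℚ`-semialgebraic half-cylinders, any additive `H`
killing constants and restricting families to `{z 0 ∈ S}` maps the closure of the `S`-respecting
generators into `relations` — generator by generator (`wallRestrict_domainAddRel`,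
`wallRestrict_integrandAddRel`, `wallRestrict_changeOfVariablesRel`, `wallRestrict_newtonLeibnizRel`).
[folklore] -/
theorem sideRestrict_of_side (S : Set ℝ)
    (hSA : ∀ k : ℕ, Literature.ModelTheory.ExponentialFields.IsSemialgebraic ℚ
      {z : Fin (k + 1) → ℝ | z 0 ∈ S})
    (H : FormalRep →+ FormalRep) (h0 : ∀ r : IntegralRep 0, H (of r) = 0)
    (hpin : ∀ (k : ℕ) (r s : IntegralRep (k + 1)), s.domain = r.domain ∩ {z | z 0 ∈ S} →
      s.integrand = r.integrand → H (of r) = of s)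
    {x : FormalRep}
    (hx : x ∈ AddSubgroup.closure (domainAddRel ∪ integrandAddRel ∪
          {x | ∃ (n : ℕ) (r r' : IntegralRep (n + 1)) (Φ : (Fin (n + 1) → ℝ) → (Fin (n + 1) → ℝ))
              (Φ' : (Fin (n + 1) → ℝ) → (Fin (n + 1) → ℝ) →L[ℝ] (Fin (n + 1) → ℝ)),
            IsSemialgebraicMapOn ℚ r.domain Φ ∧
            (∀ x ∈ r.domain, HasFDerivWithinAt Φ (Φ' x) r.domain x) ∧ Set.InjOn Φ r.domain ∧
            r'.domain = Φ '' r.domain ∧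
            (∀ x ∈ r.domain, r.integrand x = r'.integrand (Φ x) * |(Φ' x).det|) ∧
            (∀ x ∈ r.domain, Φ x 0 ∈ S ↔ x 0 ∈ S) ∧
            x = of r - of r'} ∪
          fibredNewtonLeibnizRel)) :
    H x ∈ relations := by
  refine (AddSubgroup.closure_le (relations.comap H)).mpr ?_ hx
  rintro y (((hy | hy) | hy) | hy)
  · obtain ⟨k, r, r₁, r₂, hdom, hnull, h₁, h₂, rfl⟩ := hy
    rw [AddSubgroup.coe_comap, mem_preimage, map_sub, map_sub]
    cases k with
    | zero =>
      rw [h0 r, h0 r₁, h0 r₂, sub_zero, sub_zero]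
      exact relations.zero_mem
    | succ k =>
      obtain ⟨s, hs, hsi⟩ := wallRestrict_exists_restrict (hSA k) r
      obtain ⟨s₁, hs₁, hs₁i⟩ := wallRestrict_exists_restrict (hSA k) r₁
      obtain ⟨s₂, hs₂, hs₂i⟩ := wallRestrict_exists_restrict (hSA k) r₂
      rw [hpin k r s hs hsi, hpin k r₁ s₁ hs₁ hs₁i, hpin k r₂ s₂ hs₂ hs₂i]
      exact domainAddRel_subset_relations
        (wallRestrict_domainAddRel hdom hnull h₁ h₂ hs hsi hs₁ hs₁i hs₂ hs₂i)
  · obtain ⟨k, r, r₁, r₂, h₁, h₂, hadd, rfl⟩ := hy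
    rw [AddSubgroup.coe_comap, mem_preimage, map_sub, map_sub]
    cases k with
    | zero =>
      rw [h0 r, h0 r₁, h0 r₂, sub_zero, sub_zero]
      exact relations.zero_mem
    | succ k =>
      obtain ⟨s, hs, hsi⟩ := wallRestrict_exists_restrict (hSA k) r
      obtain ⟨s₁, hs₁, hs₁i⟩ := wallRestrict_exists_restrict (hSA k) r₁
      obtain ⟨s₂, hs₂, hs₂i⟩ := wallRestrict_exists_restrict (hSA k) r₂
      rw [hpin k r s hs hsi, hpin k r₁ s₁ hs₁ hs₁i, hpin k r₂ s₂ hs₂ hs₂i]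
      exact integrandAddRel_subset_relations
        (wallRestrict_integrandAddRel h₁ h₂ hadd hs hsi hs₁ hs₁i hs₂ hs₂i)
  · obtain ⟨k, r, r', Φ, Φ', hΦ, hΦ', hinj, hdom, hf, hside, rfl⟩ := hy
    rw [AddSubgroup.coe_comap, mem_preimage, map_sub]
    obtain ⟨s, hs, hsi⟩ := wallRestrict_exists_restrict (hSA k) r
    obtain ⟨s', hs', hs'i⟩ := wallRestrict_exists_restrict (hSA k) r'
    rw [hpin k r s hs hsi, hpin k r' s' hs' hs'i]
    exact changeOfVariablesRel_subset_relations
      (wallRestrict_changeOfVariablesRel S hΦ hΦ' hinj hdom hf hside hs hsi hs' hs'i)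
  · obtain ⟨k, r, r', α, β, F, hF, hα, hβ, hle, hband, hcont, hderiv, hr', rfl⟩ :=
      mem_fibredNewtonLeibnizRel_iff.mp hy
    rw [AddSubgroup.coe_comap, mem_preimage, map_sub]
    obtain ⟨s, hs, hsi⟩ := wallRestrict_exists_restrict (hSA (k + 1)) r
    obtain ⟨s', hs', hs'i⟩ := wallRestrict_exists_restrict (hSA k) r'
    rw [hpin (k + 1) r s hs hsi, hpin k r' s' hs' hs'i]
    exact newtonLeibnizRel_subset_relations
      (wallRestrict_newtonLeibnizRel S hF hα hβ hle hband hcont hderiv hr' hs hsi hs' hs'i)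

/-- The `S`-respecting generators are relations (drop the side clause), so their closure is
`≤ relations`. [folklore] -/
theorem sideClosure_le_relations (S : Set ℝ) :
    AddSubgroup.closure (domainAddRel ∪ integrandAddRel ∪
          {x | ∃ (n : ℕ) (r r' : IntegralRep (n + 1)) (Φ : (Fin (n + 1) → ℝ) → (Fin (n + 1) → ℝ))
              (Φ' : (Fin (n + 1) → ℝ) → (Fin (n + 1) → ℝ) →L[ℝ] (Fin (n + 1) → ℝ)),
            IsSemialgebraicMapOn ℚ r.domain Φ ∧
            (∀ x ∈ r.domain, HasFDerivWithinAt Φ (Φ' x) r.domain x) ∧ Set.InjOn Φ r.domain ∧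
            r'.domain = Φ '' r.domain ∧
            (∀ x ∈ r.domain, r.integrand x = r'.integrand (Φ x) * |(Φ' x).det|) ∧
            (∀ x ∈ r.domain, Φ x 0 ∈ S ↔ x 0 ∈ S) ∧
            x = of r - of r'} ∪
          fibredNewtonLeibnizRel) ≤ relations := by
  refine (AddSubgroup.closure_le relations).mpr ?_
  rintro y (((hy | hy) | hy) | hy)
  · exact domainAddRel_subset_relations hy
  · exact integrandAddRel_subset_relations hy
  · obtain ⟨k, r, r', Φ, Φ', hΦ, hΦ', hinj, hdom, hf, -, rfl⟩ := hy
    exact changeOfVariablesRel_subset_relations ⟨k + 1, r, r', Φ, Φ', hΦ, hΦ', hinj, hdom, hf, rfl⟩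
  · exact newtonLeibnizRel_subset_relations (fibredNewtonLeibnizRel_subset_newtonLeibnizRel hy)

/-! ### Side lift: on the disc family a side restriction computes `[D_S] * c` -/

/-- **The side restriction of the pinned family is the reindexed `D_S × t`**: if `s` has domain
`(P m t).domain ∩ {z 0 ∈ S}` and the integrand of `P m t`, and `D_S` has domain
`piDisc ∩ {z 0 ∈ S}` and integrand `1`, then `s = (D_S × t).reindex (Fin (2 + m) ≃ Fin (m + 2))`
(`KZ.IntegralRep.ext'`). [folklore] -/
theorem pinned_sideRestrict_eq_reindex
    (P : ∀ n : ℕ, IntegralRep n → IntegralRep (n + 2))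
    (hP : ∀ (n : ℕ) (r : IntegralRep n),
      (P n r).domain = {z : Fin (n + 2) → ℝ | z 0 ^ 2 + z 1 ^ 2 ≤ 1 ∧ (fun i : Fin n => z i.succ.succ) ∈ r.domain} ∧
      (P n r).integrand = fun z => r.integrand (fun i : Fin n => z i.succ.succ))
    (S : Set ℝ) {DS : IntegralRep 2} (hDS : DS.domain = piDisc ∩ {z | z 0 ∈ S})
    (hDS1 : DS.integrand = fun _ => 1) (m : ℕ) (t : IntegralRep m) {s : IntegralRep (m + 2)}
    (hs : s.domain = (P m t).domain ∩ {z | z 0 ∈ S}) (hsi : s.integrand = (P m t).integrand) :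
    s = (DS.prod t).reindex (finCongr (Nat.add_comm 2 m)) := by
  refine IntegralRep.ext' ?_ ?_
  · rw [hs]
    ext z
    simp only [(hP m t).1, IntegralRep.reindex_domain, IntegralRep.prod_domain,
      IntegralRep.mem_prodDomain, hDS, mem_inter_iff, mem_setOf_eq, mem_piDisc,
      piIndex_castAdd_zero, piIndex_castAdd_one, piIndex_natAdd]
    exact and_right_comm
  · rw [hsi]
    funext z
    simp only [(hP m t).2, IntegralRep.reindex_integrand, IntegralRep.prod_integrand_eq,
      IntegralRep.prodFun, hDS1, one_mul, piIndex_natAdd]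

/-- **Side lift**: `[D_S] * c − H (lift (of ∘ P) c) ∈ relations` for any side restriction `H` to
`{z 0 ∈ S}` (both sides additive in `c`; on a generator `[t]`, `H [P t] = [(P t) ∩ {z 0 ∈ S}]` is the
reindexed `[D_S × t] = [D_S] * [t]`, one rule-(2) move `KZ.of_sub_of_reindex_mem_relations`).
[folklore] -/
theorem sideLift
    (P : ∀ n : ℕ, IntegralRep n → IntegralRep (n + 2))
    (hP : ∀ (n : ℕ) (r : IntegralRep n),
      (P n r).domain = {z : Fin (n + 2) → ℝ | z 0 ^ 2 + z 1 ^ 2 ≤ 1 ∧ (fun i : Fin n => z i.succ.succ) ∈ r.domain} ∧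
      (P n r).integrand = fun z => r.integrand (fun i : Fin n => z i.succ.succ))
    (S : Set ℝ)
    (hSA : ∀ k : ℕ, Literature.ModelTheory.ExponentialFields.IsSemialgebraic ℚ
      {z : Fin (k + 1) → ℝ | z 0 ∈ S})
    {DS : IntegralRep 2} (hDS : DS.domain = piDisc ∩ {z | z 0 ∈ S}) (hDS1 : DS.integrand = fun _ => 1)
    (H : FormalRep →+ FormalRep)
    (hpin : ∀ (k : ℕ) (r s : IntegralRep (k + 1)), s.domain = r.domain ∩ {z | z 0 ∈ S} →
      s.integrand = r.integrand → H (of r) = of s)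
    (c : FormalRep) :
    of DS * c - H (FreeAbelianGroup.lift (fun s : (Σ n, IntegralRep n) => of (P s.1 s.2)) c) ∈
      relations := by
  induction c using FreeAbelianGroup.induction_on with
  | zero => simp [relations.zero_mem]
  | of x =>
    obtain ⟨m, t⟩ := x
    rw [FreeAbelianGroup.lift_apply_of]
    obtain ⟨s, hs, hsi⟩ := wallRestrict_exists_restrict (hSA (m + 1)) (P m t)
    change of DS * of t - H (of (P m t)) ∈ relations
    rw [hpin (m + 1) (P m t) s hs hsi, pinned_sideRestrict_eq_reindex P hP S hDS hDS1 m t hs hsi,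
      of_mul_of]
    exact of_sub_of_reindex_mem_relations _ _
  | neg x ih =>
    rw [mul_neg, map_neg, map_neg, ← neg_sub']
    exact relations.neg_mem ih
  | add x y hx hy =>
    rw [mul_add, map_add, map_add, ← sub_add_sub_comm]
    exact relations.add_mem hx hy

/-! ### The master theorem -/

/-- **SIDE DESCENT (master theorem of the restriction method).** Let `S ⊆ ℝ` be a side set with
`ℚ`-semialgebraic half-cylinders and `D_S` a representation of the disc piece `D ∩ {x ∈ S}`
(integrand `1`) which FINISHES: `[D_S]·c ∈ relations` and `[π]·c ∈ relations` force
`c ∈ relations`. Then `π`-cancellation (item 0540) holds for every pinned disc family `P` and every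
certificate `lift (of ∘ P) c` lying in the closure of the `S`-respecting generators. [folklore] -/
theorem sideDescent :
    ∀ (S : Set ℝ), (∀ k : ℕ, Literature.ModelTheory.ExponentialFields.IsSemialgebraic ℚ {z : Fin (k + 1) → ℝ | z 0 ∈ S}) → ∀ {DS : IntegralRep 2}, DS.domain = piDisc ∩ {z | z 0 ∈ S} → (DS.integrand = fun _ => 1) → (∀ c : FormalRep, of DS * c ∈ relations → of piRep * c ∈ relations → c ∈ relations) → ∀ (P : ∀ n : ℕ, IntegralRep n → IntegralRep (n + 2)), (∀ (n : ℕ) (r : IntegralRep n), (P n r).domain = {z : Fin (n + 2) → ℝ | z 0 ^ 2 + z 1 ^ 2 ≤ 1 ∧ (fun i : Fin n => z i.succ.succ) ∈ r.domain} ∧ (P n r).integrand = fun z => r.integrand (fun i : Fin n => z i.succ.succ)) → ∀ (c : FormalRep), FreeAbelianGroup.lift (fun s : (Σ n, IntegralRep n) => of (P s.1 s.2)) c ∈ AddSubgroup.closure (domainAddRel ∪ integrandAddRel ∪ {x | ∃ (n : ℕ) (r r' : IntegralRep (n + 1)) (Φ : (Fin (n + 1) → ℝ) → (Fin (n + 1)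 → ℝ)) (Φ' : (Fin (n + 1) → ℝ) → (Fin (n + 1) → ℝ) →L[ℝ] (Fin (n + 1) → ℝ)), IsSemialgebraicMapOn ℚ r.domain Φ ∧ (∀ x ∈ r.domain, HasFDerivWithinAt Φ (Φ' x) r.domain x) ∧ Set.InjOn Φ r.domain ∧ r'.domain = Φ '' r.domain ∧ (∀ x ∈ r.domain, r.integrand x = r'.integrand (Φ x) * |(Φ' x).det|) ∧ (∀ x ∈ r.domain, Φ x 0 ∈ S ↔ x 0 ∈ S) ∧ x = of r - of r'} ∪ fibredNewtonLeibnizRel) → c ∈ relations := by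
  intro S hSA DS hDS hDS1 hfin P hP c hc
  obtain ⟨H, h0, hpin⟩ := exists_sideRestrict S hSA
  have h1 := sideRestrict_of_side S hSA H h0 hpin hc
  have h2 := sideLift P hP S hSA hDS hDS1 H hpin c
  have hS : of DS * c ∈ relations := by
    simpa using relations.add_mem h2 h1
  have hπ : of piRep * c ∈ relations := by
    have h3 := piRep_mul_sub_lift_mem_relations P hP c
    have h4 := sideClosure_le_relations S hc
    simpa using relations.add_mem h3 h4
  exact hfin c hS hπ

/-- **Disc multiples of relations are `S`-respecting relations for EVERY side set `S`**:
`[π]·relations ⊆ fibredRelations` (`stub_piMulFibred`), and a fibred change of variables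
(`Φ x 0 = x 0`) trivially preserves `{x 0 ∈ S}`. [folklore] -/
theorem piMul_mem_sideClosure (S : Set ℝ)
    (P : ∀ n : ℕ, IntegralRep n → IntegralRep (n + 2))
    (hP : ∀ (n : ℕ) (r : IntegralRep n),
      (P n r).domain = {z : Fin (n + 2) → ℝ | z 0 ^ 2 + z 1 ^ 2 ≤ 1 ∧ (fun i : Fin n => z i.succ.succ) ∈ r.domain} ∧
      (P n r).integrand = fun z => r.integrand (fun i : Fin n => z i.succ.succ))
    (c : FormalRep) (hc : c ∈ relations) :
    FreeAbelianGroup.lift (fun s : (Σ n, IntegralRep n) => of (P s.1 s.2)) c ∈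
          AddSubgroup.closure (domainAddRel ∪ integrandAddRel ∪
          {x | ∃ (n : ℕ) (r r' : IntegralRep (n + 1)) (Φ : (Fin (n + 1) → ℝ) → (Fin (n + 1) → ℝ))
              (Φ' : (Fin (n + 1) → ℝ) → (Fin (n + 1) → ℝ) →L[ℝ] (Fin (n + 1) → ℝ)),
            IsSemialgebraicMapOn ℚ r.domain Φ ∧
            (∀ x ∈ r.domain, HasFDerivWithinAt Φ (Φ' x) r.domain x) ∧ Set.InjOn Φ r.domain ∧
            r'.domain = Φ '' r.domain ∧
            (∀ x ∈ r.domain, r.integrand x = r'.integrand (Φ x) * |(Φ' x).det|) ∧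
            (∀ x ∈ r.domain, Φ x 0 ∈ S ↔ x 0 ∈ S) ∧
            x = of r - of r'} ∪
          fibredNewtonLeibnizRel) := by
  have hfib := stub_piMulFibred P hP c hc
  rw [fibredRelations_def] at hfib
  refine AddSubgroup.closure_mono ?_ hfib
  rw [fibredGenerators_def]
  rintro y (((hy | hy) | hy) | hy)
  · exact Or.inl (Or.inl (Or.inl hy))
  · exact Or.inl (Or.inl (Or.inr hy))
  · obtain ⟨k, r, r', Φ, Φ', hΦ, hΦ', hinj, hdom, hf, h0, rfl⟩ := hy
    exact Or.inl (Or.inr ⟨k, r, r', Φ, Φ', hΦ, hΦ', hinj, hdom, hf,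
      fun x hx => by rw [h0 x hx], rfl⟩)
  · exact Or.inr hy

/-- **Item 0540 ⟺ `S`-REDUCTION, for every finishing side set `S`**: `AyoubPiCancellation` holds iff
every relation among disc multiples is an `S`-respecting relation. [folklore] -/
theorem ayoubPiCancellation_iff_sideReduction (S : Set ℝ)
    (hSA : ∀ k : ℕ, Literature.ModelTheory.ExponentialFields.IsSemialgebraic ℚ
      {z : Fin (k + 1) → ℝ | z 0 ∈ S})
    {DS : IntegralRep 2} (hDS : DS.domain = piDisc ∩ {z | z 0 ∈ S}) (hDS1 : DS.integrand = fun _ => 1)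
    (hfin : ∀ c : FormalRep, of DS * c ∈ relations → of piRep * c ∈ relations → c ∈ relations) :
    Summit.KontsevichZagierPeriods.KontsevichZagierPeriods.Theses.AyoubSpecialisation.AyoubPiCancellation ↔
    ∀ (P : ∀ n : ℕ, IntegralRep n → IntegralRep (n + 2)),
      (∀ (n : ℕ) (r : IntegralRep n), (P n r).domain = {z : Fin (n + 2) → ℝ | z 0 ^ 2 + z 1 ^ 2 ≤ 1 ∧ (fun i : Fin n => z i.succ.succ) ∈ r.domain} ∧ (P n r).integrand = fun z => r.integrand (fun i : Fin n => z i.succ.succ)) →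
      ∀ c : FormalRep,
        FreeAbelianGroup.lift (fun s : (Σ n, IntegralRep n) => of (P s.1 s.2)) c ∈ relations →
        FreeAbelianGroup.lift (fun s : (Σ n, IntegralRep n) => of (P s.1 s.2)) c ∈
          AddSubgroup.closure (domainAddRel ∪ integrandAddRel ∪
          {x | ∃ (n : ℕ) (r r' : IntegralRep (n + 1)) (Φ : (Fin (n + 1) → ℝ) → (Fin (n + 1) → ℝ))
              (Φ' : (Fin (n + 1) → ℝ) → (Fin (n + 1) → ℝ) →L[ℝ] (Fin (n + 1) → ℝ)),
            IsSemialgebraicMapOn ℚ r.domain Φ ∧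
            (∀ x ∈ r.domain, HasFDerivWithinAt Φ (Φ' x) r.domain x) ∧ Set.InjOn Φ r.domain ∧
            r'.domain = Φ '' r.domain ∧
            (∀ x ∈ r.domain, r.integrand x = r'.integrand (Φ x) * |(Φ' x).det|) ∧
            (∀ x ∈ r.domain, Φ x 0 ∈ S ↔ x 0 ∈ S) ∧
            x = of r - of r'} ∪
          fibredNewtonLeibnizRel) := by
  constructor
  · intro h P hP c hc
    exact piMul_mem_sideClosure S P hP c (h P hP c hc)
  · intro h P hP c hc
    exact sideDescent S hSA hDS hDS1 hfin P hP c (h P hP c hc)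

end Summit.KontsevichZagierPeriods.KontsevichZagierPeriods.BetaCancellationLine
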